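import Mathlib
import Literature.Analysis.FluidPDE.VectorCalculus

/-!
# Velocity rows of the corrector equation as a differential inequality

Crux stmt-NavierStokesRegularity-1429
(`Summit.NavierStokesRegularity.NavierStokesRegularity.Theses.AdiabaticEddy.CorrectorSolvable`),
line Sketch (stokes-carleman-kill), stub `correctorKill_velocityBound`.

The first-order corrector equation
(★) `(U·∇)W + (W·∇)U + ∇q = ΔU − aU + b(y·∇)U + (c·∇)U`
is read as a Stokes-type system for `(U, q)` with the smooth field `W` as a coefficient. Solving (★)
for `ΔU` pointwise and bounding `W`, `DW` and `|y|` on the compact ball `closedBall x₀ R` gives the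
elliptic differential inequality `‖ΔU(y)‖ ≤ C (‖U(y)‖ + ‖DU(y)‖ + ‖Dq(y)‖)` on `ball x₀ R`
(`‖∇q‖ = ‖Dq‖` by the Riesz isometry). No regularity of `U` or `q` is needed: (★) pins `ΔU` down.
Mathlib-only apart from the tree's `Literature.Analysis.FluidPDE.convect`.
-/

noncomputable section

-- the summit-side namespace `Summit.NavierStokesRegularity.NavierStokesRegularity.…` repeats a component by design (D-0017)
set_option linter.dupNamespace false

namespace Summit.NavierStokesRegularity.NavierStokesRegularity.Theorems

open Set Metric InnerProductSpace

/-- **Velocity rows of (★) as a differential inequality.** From the corrector equation,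
`ΔU = (U·∇)W + (W·∇)U + ∇q + aU − b(y·∇)U − (c·∇)U` pointwise, and on a ball the `C¹`
coefficient `W`, its derivative and `|y|` are bounded, so
`‖ΔU(y)‖ ≤ C (‖U(y)‖ + ‖DU(y)‖ + ‖Dq(y)‖)` for `y ∈ B(x₀, R)` (`‖∇q‖ = ‖Dq‖`, Riesz). No regularity
of `U` or `q` is needed: (★) pins `ΔU` down. [folklore] -/
theorem correctorKill_velocityBound
    (U W : EuclideanSpace ℝ (Fin 3) → EuclideanSpace ℝ (Fin 3)) (q : EuclideanSpace ℝ (Fin 3) → ℝ)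
    (a b : ℝ) (c : EuclideanSpace ℝ (Fin 3)) (hW : ContDiff ℝ 1 W)
    (hcorr : ∀ y, Literature.Analysis.FluidPDE.convect U W y +
      Literature.Analysis.FluidPDE.convect W U y + gradient q y =
      Laplacian.laplacian U y - a • U y + b • (fderiv ℝ U y) y + (fderiv ℝ U y) c)
    (x₀ : EuclideanSpace ℝ (Fin 3)) (R : ℝ) :
    ∃ C : ℝ, 0 ≤ C ∧ ∀ y ∈ Metric.ball x₀ R,
      ‖Laplacian.laplacian U y‖ ≤ C * (‖U y‖ + ‖fderiv ℝ U y‖ + ‖fderiv ℝ q y‖) := by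
  -- uniform bounds for the coefficients `W`, `DW` and `y` on the compact closed ball
  obtain ⟨M₀, hM₀⟩ := (isCompact_closedBall x₀ R).exists_bound_of_continuousOn
    hW.continuous.continuousOn
  obtain ⟨M₁, hM₁⟩ := (isCompact_closedBall x₀ R).exists_bound_of_continuousOn
    (hW.continuous_fderiv one_ne_zero).continuousOn
  obtain ⟨M₂, hM₂⟩ := (isCompact_closedBall x₀ R).exists_bound_of_continuousOn
    (continuousOn_id (s := closedBall x₀ R))
  refine ⟨|M₁| + |a| + |M₀| + |b| * |M₂| + ‖c‖ + 1, by positivity, fun y hy => ?_⟩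
  have hy' : y ∈ closedBall x₀ R := ball_subset_closedBall hy
  have hWy : ‖W y‖ ≤ |M₀| := (hM₀ y hy').trans (le_abs_self _)
  have hDWy : ‖fderiv ℝ W y‖ ≤ |M₁| := (hM₁ y hy').trans (le_abs_self _)
  have hyn : ‖y‖ ≤ |M₂| := (hM₂ y hy').trans (le_abs_self _)
  -- solve (★) for `ΔU y`
  have key : Laplacian.laplacian U y =
      (Literature.Analysis.FluidPDE.convect U W y + Literature.Analysis.FluidPDE.convect W U y +
        gradient q y) + a • U y - b • (fderiv ℝ U y) y - (fderiv ℝ U y) c := by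
    rw [hcorr y]; abel
  -- the six terms
  have hA : ‖Literature.Analysis.FluidPDE.convect U W y‖ ≤ |M₁| * ‖U y‖ := by
    rw [Literature.Analysis.FluidPDE.convect_apply]
    exact ((fderiv ℝ W y).le_opNorm (U y)).trans
      (mul_le_mul_of_nonneg_right hDWy (norm_nonneg _))
  have hB : ‖Literature.Analysis.FluidPDE.convect W U y‖ ≤ |M₀| * ‖fderiv ℝ U y‖ := by
    rw [Literature.Analysis.FluidPDE.convect_apply, mul_comm]
    exact ((fderiv ℝ U y).le_opNorm (W y)).trans
      (mul_le_mul_of_nonneg_left hWy (norm_nonneg _))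
  have hG : ‖gradient q y‖ = ‖fderiv ℝ q y‖ := (InnerProductSpace.toDual ℝ _).symm.norm_map _
  have ha : ‖a • U y‖ = |a| * ‖U y‖ := by rw [norm_smul, Real.norm_eq_abs]
  have hb : ‖b • (fderiv ℝ U y) y‖ ≤ |b| * |M₂| * ‖fderiv ℝ U y‖ := by
    rw [norm_smul, Real.norm_eq_abs, mul_assoc]
    refine mul_le_mul_of_nonneg_left ?_ (abs_nonneg b)
    rw [mul_comm]
    exact ((fderiv ℝ U y).le_opNorm y).trans (mul_le_mul_of_nonneg_left hyn (norm_nonneg _))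
  have hc : ‖(fderiv ℝ U y) c‖ ≤ ‖c‖ * ‖fderiv ℝ U y‖ := by
    rw [mul_comm]; exact (fderiv ℝ U y).le_opNorm c
  -- triangle inequality
  have htri : ‖(Literature.Analysis.FluidPDE.convect U W y +
      Literature.Analysis.FluidPDE.convect W U y + gradient q y) + a • U y - b • (fderiv ℝ U y) y -
        (fderiv ℝ U y) c‖ ≤
      ‖Literature.Analysis.FluidPDE.convect U W y‖ + ‖Literature.Analysis.FluidPDE.convect W U y‖ +
        ‖gradient q y‖ + ‖a • U y‖ + ‖b • (fderiv ℝ U y) y‖ + ‖(fderiv ℝ U y) c‖ := by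
    have h1 := norm_sub_le ((Literature.Analysis.FluidPDE.convect U W y +
      Literature.Analysis.FluidPDE.convect W U y + gradient q y) + a • U y - b • (fderiv ℝ U y) y)
      ((fderiv ℝ U y) c)
    have h2 := norm_sub_le ((Literature.Analysis.FluidPDE.convect U W y +
      Literature.Analysis.FluidPDE.convect W U y + gradient q y) + a • U y) (b • (fderiv ℝ U y) y)
    have h3 := norm_add_le (Literature.Analysis.FluidPDE.convect U W y +
      Literature.Analysis.FluidPDE.convect W U y + gradient q y) (a • U y)
    have h4 := norm_add_le (Literature.Analysis.FluidPDE.convect U W y +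
      Literature.Analysis.FluidPDE.convect W U y) (gradient q y)
    have h5 := norm_add_le (Literature.Analysis.FluidPDE.convect U W y)
      (Literature.Analysis.FluidPDE.convect W U y)
    linarith
  -- bookkeeping
  have hu : 0 ≤ ‖U y‖ := norm_nonneg _
  have hd : 0 ≤ ‖fderiv ℝ U y‖ := norm_nonneg _
  have hp : 0 ≤ ‖fderiv ℝ q y‖ := norm_nonneg _
  have hbM : 0 ≤ |b| * |M₂| := by positivity
  have h1 : (|M₁| + |a|) * ‖U y‖ ≤ (|M₁| + |a| + |M₀| + |b| * |M₂| + ‖c‖ + 1) * ‖U y‖ :=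
    mul_le_mul_of_nonneg_right (by linarith [abs_nonneg M₀, norm_nonneg c]) hu
  have h2 : (|M₀| + |b| * |M₂| + ‖c‖) * ‖fderiv ℝ U y‖ ≤
      (|M₁| + |a| + |M₀| + |b| * |M₂| + ‖c‖ + 1) * ‖fderiv ℝ U y‖ :=
    mul_le_mul_of_nonneg_right (by linarith [abs_nonneg M₁, abs_nonneg a]) hd
  have h3 : ‖fderiv ℝ q y‖ ≤ (|M₁| + |a| + |M₀| + |b| * |M₂| + ‖c‖ + 1) * ‖fderiv ℝ q y‖ :=
    le_mul_of_one_le_left hp (by linarith [abs_nonneg M₁, abs_nonneg a, abs_nonneg M₀, norm_nonneg c])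
  rw [key]
  linarith [htri, hA, hB, hG, ha, hb, hc, h1, h2, h3]

end Summit.NavierStokesRegularity.NavierStokesRegularity.Theorems

end
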